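import Summits.BirchSwinnertonDyer.BirchSwinnertonDyer.Theorems.GoldfeldAllTwistsTwoConverseTwinAdditiveTwoPrimesTwistSelmerDualThreeModEightPOne
import Summits.BirchSwinnertonDyer.BirchSwinnertonDyer.Theorems.GoldfeldAllTwistsTwoConverseTwinAdditiveTwoPrimesTwistSelmerDualLocalThreeModEightPOneAlpha
import HarnessLib

set_option linter.dupNamespace false -- namespace `…BirchSwinnertonDyer.BirchSwinnertonDyer…` is the cell's (D-0017 nested layout)
set_option autoImplicit false

/-!
# First descent on the stratum `q ≡ 3 (8)`, `p ≡ 1 (8)` of the two-prime family `W ≅ 49a1^{(−2qp)}` WITHOUT type or `(p/q)` condition: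
# the dual Selmer set `S′ = S(84qp, −28q²p²) ⊆ {1, −7, 2, −14, p, −7p, 2p, −14p}` (`#S′ ≤ 8`) — the `(4,8)` cells b31+ AND C1 included

Cell `bsd-goldfeld`, seat `bsd-goldfeld-s1p-c3x` (gen 21); planner RULING (cdxxxviii), OPTIONAL OBJECT 10 «FIRST-DESCENT UPPER BOUNDS ON THE (4,8)
CELLS», TRANCHE B (b31+) ∪ the C1 half of TRANCHE C, file 1 of 2. `--supports stmt-BirchSwinnertonDyer-20044` as a HELPER (rank axis). FACT-FREE:
no print binder, no definition, no `sorry`; Theses-free.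

THE STRATUM. `q ≡ 3 (mod 8)` prime with `(q/7) = −1`; `p ≡ 1 (mod 8)` prime with `(−7/p) = +1`. It is the union of the two SHARP cells (β, `(p/q) = −1`)
(`…SelmerDualThreeModEightPOne`: `S′ ⊆ {1, −7, 2, −14}`) and a31+ (α, `(p/q) = +1`; `…SelmerDualThreeModEightPlusPOneAlpha`) and the two NON-SHARP `(4,8)`
cells **C1 (α, `(p/q) = −1`)** and **b31+ (β, `(p/q) = +1`)**, on both of which the kit gives `S′ = {1, 2, −7, −14, p, 2p, −7p, −14p}` (j332292: 118/118
rows on C1 ∪ C2; j332195: 84/84 rows on b31+; memo `HOME/NONSHARP-CHIZ-VANISHING.md` §0) and rank `3` occurs (`(19,337)` on C1, `(139,193)` on b31+: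
`3 ≤ rank W(ℚ)` are the kernel theorems `three_le_mordellWeilRank_twoPrimesTwist_19_337 / _139_193` of OBJECT 9).

THIS FILE proves the UPPER half on the dual side, uniformly on the stratum. The proof is the (β, −) cell's (`twoIsogenySelmerGroup'_twoPrimesTwist_subset_
threeModEightPOne`) with every kill that used `(p/q) = −1` or the type DELETED and the `p`-adic non-residue kills of `−q, 7q, −2q, 14q` replaced by
the symbol-free `2`-adic kills of a31+'s local file: of the thirty-two squarefree divisors `d` of `−28q²p²`, SIXTEEN die at `7`
(`not_isSoluble_seven_dual(′)`, using only `(q/7) = −1`, `(p/7) = +1`), EIGHT die at `2` — `−q, 7q, −2q, 14q` (`not_isSoluble_two_dual_negQ_threeOne`,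
`…sevenQ_threeOne`, `…negTwoQ_threeOne`, `…fourteenQ_threeOne`, `…SelmerDualLocalThreeModEightPOneAlpha`) and `−qp, 7qp, −2qp, 14qp`
(`not_isSoluble_two_dual_negQP_threeOne`, `…sevenQP_threeOne`, `…negTwoQP_threeOne`, `…fourteenQP_threeOne`, `…TwinAdditiveTwoAdicThreeModEightPOne`), using
only `q ≡ 3 (8)`, `p ≡ 1 (8)` — and the EIGHT survivors are `{1, −7, 2, −14, p, −7p, 2p, −14p}` (`#S′ ≤ 8`): at `q ≡ 3 (mod 8)` NO class divisible by `q`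
survives, and `2, −14` do (versus `q ≡ 7 (mod 8)`, file `…TwinNonSharpSelmerDualEightOne`). File 2 (`…TwinNonSharpRankLeThreeThreeOne`) bounds `S` and
draws `rank W(ℚ) ≤ 3` for every `W` on the stratum, `= 3` attained on C1 and on b31+.
HONEST FRAMING: the textbook first-descent bound made kernel for this family; an obstruction / structure datum on twist-density-ZERO cells; changes NO
width (C1: BARRIER cell; b31+: second descent / `rk₄ ≥ 1` — both stay director width; this is not a road to rank one); items 19350 / 20044 / 19140
SUPPORT only, neither closed nor advanced; BSD is not proved by any of this.

References: [SilvermanAEC2009] Prop. X.4.9, Example X.4.10; [Zywina2025] Lemma 3.1 (proof); [Serre1973] Ch. II §3.3 Thm 4.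
-/

noncomputable section

open scoped Classical

open WeierstrassCurve Literature.NumberTheory.EllipticCurves

namespace Summit.BirchSwinnertonDyer.BirchSwinnertonDyer.Theorems.GoldfeldGoodTwists

section SelmerDualThreeOne
variable {q p : ℕ} [Fact q.Prime] [Fact p.Prime]

omit [Fact q.Prime] [Fact p.Prime] in
/-- `7 ∤ a`, `7 ∤ b` ⇒ `7 ∤ ab`. [folklore] -/
private theorem not_seven_dvd_mul_threeOne {a b : ℤ} (ha : ¬ (7 : ℤ) ∣ a) (hb : ¬ (7 : ℤ) ∣ b) : ¬ (7 : ℤ) ∣ a * b := fun h ↦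
  ((Int.prime_iff_natAbs_prime.mpr (by norm_num) : Prime (7 : ℤ)).dvd_or_dvd h).elim ha hb

/-- The stratum's symbol-free arithmetic facts at `7` (no `(p/q)`, no type): `q ≠ p`, `7 ∤ qp`, `legendreSym 7 q = −1`, `legendreSym 7 p = +1`.
[folklore] -/
private theorem facts_threeOne (hq8 : q % 8 = 3) (hq7 : jacobiSym q 7 = -1) (hp8 : p % 8 = 1) (hp7 : legendreSym p (-7) = 1) :
    (q ≠ p ∧ ¬ 7 ∣ q * p ∧ ¬ (7 : ℤ) ∣ q ∧ ¬ (7 : ℤ) ∣ p) ∧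
    (legendreSym 7 q = -1 ∧ legendreSym 7 p = 1 ∧ ((q : ℤ) : ZMod 7) ≠ 0 ∧ ((p : ℤ) : ZMod 7) ≠ 0) := by
  have hq : q.Prime := Fact.out
  have hp : p.Prime := Fact.out
  haveI : Fact (Nat.Prime 7) := ⟨by norm_num⟩
  have hqp : q ≠ p := by rintro rfl; omega
  have hq7' : q ≠ 7 := by rintro rfl; rw [jacobiSym.mod_left] at hq7; norm_num at hq7
  have hp7' : p ≠ 7 := by rintro rfl; norm_num at hp8
  have h7Q : ¬ (7 : ℤ) ∣ q := fun h ↦ hq7' ((Nat.prime_dvd_prime_iff_eq (by norm_num) hq).mp (by exact_mod_cast h)).symm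
  have h7P : ¬ (7 : ℤ) ∣ p := fun h ↦ hp7' ((Nat.prime_dvd_prime_iff_eq (by norm_num) hp).mp (by exact_mod_cast h)).symm
  have h7qp : ¬ 7 ∣ q * p := fun h ↦ ((Nat.Prime.dvd_mul (by norm_num)).mp h).elim (fun h ↦ h7Q (by exact_mod_cast h))
    (fun h ↦ h7P (by exact_mod_cast h))
  obtain ⟨-, h7p, -⟩ := legendreSym_two_seven_neg_one_of_one_mod_eight hp8 hp7
  have h7_q : legendreSym 7 q = -1 := by rw [jacobiSym.legendreSym.to_jacobiSym]; exact_mod_cast hq7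
  have h7_p : legendreSym 7 p = 1 := by
    rw [legendreSym.quadratic_reciprocity_one_mod_four (by omega : p % 4 = 1) (by norm_num : 7 ≠ 2)]; exact h7p
  have hq07 : ((q : ℤ) : ZMod 7) ≠ 0 := by rw [Ne, ZMod.intCast_zmod_eq_zero_iff_dvd]; exact_mod_cast h7Q
  have hp07 : ((p : ℤ) : ZMod 7) ≠ 0 := by rw [Ne, ZMod.intCast_zmod_eq_zero_iff_dvd]; exact_mod_cast h7P
  exact ⟨⟨hqp, h7qp, h7Q, h7P⟩, ⟨h7_q, h7_p, hq07, hp07⟩⟩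

set_option maxHeartbeats 400000 in -- sixteen `p`-classes
/-- **§1. The classes of `S′ = S(84qp, −28q²p²)` divisible by `p` are among `p, −7p, 2p, −14p`** on the whole stratum `q ≡ 3 (8)`, `p ≡ 1 (8)`:
writing `d = p·e`, the other twelve die — `qp, 2qp, −7qp, −14qp, −p, −2p, 7p, 14p` at `7`; `−qp, 7qp, −2qp, 14qp` at `2`. (The (β, −) cell's §1 killed
also `p, −7p, 2p, −14p` at `p` by the type-β root test and `(p/q) = −1`; here they survive, as they must on C1 and b31+.)
[cite: SilvermanAEC2009, Prop. X.4.9 and Example X.4.10] -/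
theorem mem_of_prime_dvd_of_mem_twoIsogenySelmerGroup'_twoPrimesTwist_threeOne (hq8 : q % 8 = 3) (hq7 : jacobiSym q 7 = -1)
    (hp8 : p % 8 = 1) (hp7 : legendreSym p (-7) = 1)
    {d d' e : ℤ} (hsqf : Squarefree d) (hdd' : -28 * ((q : ℤ) * p) ^ 2 = d * d')
    (hpadic : ∀ (l : ℕ) [Fact l.Prime], ((twoIsogenyQuartic (84 * ((q : ℤ) * p)) d d').map (Int.castRingHom ℚ_[l])).IsSoluble)
    (hde : d = p * e) : e = 1 ∨ e = -7 ∨ e = 2 ∨ e = -14 := by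
  have hq : q.Prime := Fact.out
  have hp : p.Prime := Fact.out
  haveI : Fact (Nat.Prime 7) := ⟨by norm_num⟩
  have hqZ : Prime (q : ℤ) := Nat.prime_iff_prime_int.mp hq
  have hq0 : (q : ℤ) ≠ 0 := by exact_mod_cast hq.ne_zero
  have hp0 : (p : ℤ) ≠ 0 := by exact_mod_cast hp.ne_zero
  obtain ⟨⟨-, h7qp, h7Q, h7P⟩, ⟨h7_q, h7_p, hq07, -⟩⟩ := facts_threeOne hq8 hq7 hp8 hp7
  subst hde
  have hd'e : e * d' = -28 * (q : ℤ) ^ 2 * p := mul_left_cancel₀ hp0 (by linear_combination (-1 : ℤ) * hdd')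
  have h0 : (p : ℤ) * e ∣ -28 * ((q : ℤ) * p) ^ 2 := ⟨d', hdd'⟩
  have h1 : (p : ℤ) * e ∣ (14 * ((q : ℤ) * p)) ^ 2 := h0.trans ⟨-7, by ring⟩
  have h14qp : (p : ℤ) * e ∣ 14 * ((q : ℤ) * p) := (hsqf.dvd_pow_iff_dvd (by norm_num)).mp h1
  have he14q : e ∣ 14 * (q : ℤ) := by
    have : (p : ℤ) * e ∣ (p : ℤ) * (14 * q) := by rw [show (p : ℤ) * (14 * q) = 14 * (q * p) by ring]; exact h14qp
    exact (mul_dvd_mul_iff_left hp0).mp this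
  by_cases hqe : (q : ℤ) ∣ e
  · -- `d = qp·e₂`: all eight die (`qp, 2qp, −7qp, −14qp` at `7`; `−qp, 7qp, −2qp, 14qp` at `2`)
    exfalso
    obtain ⟨e₂, rfl⟩ := hqe
    have he14 : e₂ ∣ 14 := by
      have : (q : ℤ) * e₂ ∣ (q : ℤ) * 14 := by rw [mul_comm (q : ℤ) 14]; exact he14q
      exact (mul_dvd_mul_iff_left hq0).mp this
    have hd'e₂ : e₂ * d' = -28 * (q : ℤ) * p := mul_left_cancel₀ hq0 (by linear_combination hd'e)
    have hele : e₂ ≤ 14 := Int.le_of_dvd (by norm_num) he14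
    have hege : -14 ≤ e₂ := by have := Int.le_of_dvd (by norm_num) ((Int.neg_dvd).mpr he14); linarith
    have hne1 : e₂ ≠ 1 := by
      rintro rfl; exact not_isSoluble_seven_dual h7qp hdd'.symm (not_seven_dvd_mul_threeOne h7P (not_seven_dvd_mul_threeOne h7Q (by decide)))
        (by rw [legendreSym.mul, legendreSym.mul, h7_p, h7_q]; norm_num) (hpadic 7)
    have hne2 : e₂ ≠ 2 := by
      rintro rfl; exact not_isSoluble_seven_dual h7qp hdd'.symm (not_seven_dvd_mul_threeOne h7P (not_seven_dvd_mul_threeOne h7Q (by decide)))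
        (by rw [legendreSym.mul, legendreSym.mul, h7_p, h7_q]; norm_num) (hpadic 7)
    have hnem7 : e₂ ≠ -7 := by
      rintro rfl
      have hd'1 : d' = 4 * ((q : ℤ) * p) := mul_left_cancel₀ (by norm_num : (-7 : ℤ) ≠ 0) (by linear_combination hd'e₂)
      refine not_isSoluble_seven_dual' h7qp hdd'.symm ?_ ?_ (hpadic 7)
      · rw [hd'1]; exact not_seven_dvd_mul_threeOne (by decide) (not_seven_dvd_mul_threeOne h7Q h7P)
      · rw [hd'1, legendreSym.mul, legendreSym.mul, h7_q, h7_p]; norm_num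
    have hnem14 : e₂ ≠ -14 := by
      rintro rfl
      have hd'1 : d' = 2 * ((q : ℤ) * p) := mul_left_cancel₀ (by norm_num : (-14 : ℤ) ≠ 0) (by linear_combination hd'e₂)
      refine not_isSoluble_seven_dual' h7qp hdd'.symm ?_ ?_ (hpadic 7)
      · rw [hd'1]; exact not_seven_dvd_mul_threeOne (by decide) (not_seven_dvd_mul_threeOne h7Q h7P)
      · rw [hd'1, legendreSym.mul, legendreSym.mul, h7_q, h7_p]; norm_num
    have hnem1 : e₂ ≠ -1 := by
      rintro rfl; exact not_isSoluble_two_dual_negQP_threeOne hq8 hp8 rfl (by ring)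
        (mul_left_cancel₀ (by norm_num : (-1 : ℤ) ≠ 0) (by linear_combination hd'e₂)) (hpadic 2)
    have hne7 : e₂ ≠ 7 := by
      rintro rfl; exact not_isSoluble_two_dual_sevenQP_threeOne hq8 hp8 rfl (by ring)
        (mul_left_cancel₀ (by norm_num : (7 : ℤ) ≠ 0) (by linear_combination hd'e₂)) (hpadic 2)
    have hnem2 : e₂ ≠ -2 := by
      rintro rfl; exact not_isSoluble_two_dual_negTwoQP_threeOne hq8 hp8 rfl (by ring)
        (mul_left_cancel₀ (by norm_num : (-2 : ℤ) ≠ 0) (by linear_combination hd'e₂)) (hpadic 2)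
    have hne14 : e₂ ≠ 14 := by
      rintro rfl; exact not_isSoluble_two_dual_fourteenQP_threeOne hq8 hp8 rfl (by ring)
        (mul_left_cancel₀ (by norm_num : (14 : ℤ) ≠ 0) (by linear_combination hd'e₂)) (hpadic 2)
    obtain ⟨k, hk⟩ := he14
    interval_cases e₂ <;> omega
  · -- `q ∤ e`: `e ∣ 14`; `p`, `−7p`, `2p`, `−14p` survive
    have hcop : IsCoprime e (q : ℤ) := ((hqZ.irreducible.coprime_iff_not_dvd).mpr hqe).symm
    have he14 : e ∣ 14 := hcop.dvd_of_dvd_mul_left (by rw [mul_comm]; exact he14q)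
    have hele : e ≤ 14 := Int.le_of_dvd (by norm_num) he14
    have hege : -14 ≤ e := by have := Int.le_of_dvd (by norm_num) ((Int.neg_dvd).mpr he14); linarith
    -- at `7`: `−p`, `−2p` (test `d`), `7p`, `14p` (test `d′`)
    have hnem1 : e ≠ -1 := by
      rintro rfl; exact not_isSoluble_seven_dual h7qp hdd'.symm (not_seven_dvd_mul_threeOne h7P (by decide))
        (by rw [legendreSym.mul, h7_p]; norm_num) (hpadic 7)
    have hnem2 : e ≠ -2 := by
      rintro rfl; exact not_isSoluble_seven_dual h7qp hdd'.symm (not_seven_dvd_mul_threeOne h7P (by decide))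
        (by rw [legendreSym.mul, h7_p]; norm_num) (hpadic 7)
    have hne7 : e ≠ 7 := by
      rintro rfl
      have hd'1 : d' = -4 * ((q : ℤ) ^ 2 * p) := mul_left_cancel₀ (by norm_num : (7 : ℤ) ≠ 0) (by linear_combination hd'e)
      refine not_isSoluble_seven_dual' h7qp hdd'.symm ?_ ?_ (hpadic 7)
      · rw [hd'1]
        exact not_seven_dvd_mul_threeOne (by decide) (not_seven_dvd_mul_threeOne (by rw [sq]; exact not_seven_dvd_mul_threeOne h7Q h7Q) h7P)
      · rw [hd'1, legendreSym.mul, legendreSym.mul, legendreSym.sq_one' 7 hq07, h7_p]; norm_num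
    have hne14 : e ≠ 14 := by
      rintro rfl
      have hd'1 : d' = -2 * ((q : ℤ) ^ 2 * p) := mul_left_cancel₀ (by norm_num : (14 : ℤ) ≠ 0) (by linear_combination hd'e)
      refine not_isSoluble_seven_dual' h7qp hdd'.symm ?_ ?_ (hpadic 7)
      · rw [hd'1]
        exact not_seven_dvd_mul_threeOne (by decide) (not_seven_dvd_mul_threeOne (by rw [sq]; exact not_seven_dvd_mul_threeOne h7Q h7Q) h7P)
      · rw [hd'1, legendreSym.mul, legendreSym.mul, legendreSym.sq_one' 7 hq07, h7_p]; norm_num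
    obtain ⟨k, hk⟩ := he14
    interval_cases e <;> first | (exfalso; omega) | simp

set_option maxHeartbeats 400000 in -- sixteen classes prime to `p`
/-- **§2. `S′ = S(84qp, −28q²p²) ⊆ {1, −7, 2, −14, p, −7p, 2p, −14p}` on the whole stratum `q ≡ 3 (8)`, `(q/7) = −1`, `p ≡ 1 (8)`, `(−7/p) = +1`**
(cells (β,−), a31+, C1, b31+; sharp on C1 and b31+ by the kit). The classes prime to `p`: `d ∣ 14q`; `−1, −2, 7, 14, q, 2q, −7q, −14q` die at `7`,
`−q, 7q, −2q, 14q` at `2`, and `1, −7, 2, −14` survive. [cite: SilvermanAEC2009, Prop. X.4.9 and Example X.4.10] [cite: Zywina2025, Lemma 3.1 (proof)] -/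
theorem twoIsogenySelmerGroup'_twoPrimesTwist_subset_threeOne (hq8 : q % 8 = 3) (hq7 : jacobiSym q 7 = -1) (hp8 : p % 8 = 1)
    (hp7 : legendreSym p (-7) = 1) :
    twoIsogenySelmerGroup' (-42 * ((q : ℤ) * p)) (448 * ((q : ℤ) * p) ^ 2) ⊆
      ({1, -7, 2, -14, (p : ℤ), (p : ℤ) * -7, (p : ℤ) * 2, (p : ℤ) * -14} : Finset ℤ) := by
  have hq : q.Prime := Fact.out
  have hp : p.Prime := Fact.out
  haveI : Fact (Nat.Prime 7) := ⟨by norm_num⟩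
  have hqZ : Prime (q : ℤ) := Nat.prime_iff_prime_int.mp hq
  have hpZ : Prime (p : ℤ) := Nat.prime_iff_prime_int.mp hp
  have hq0 : (q : ℤ) ≠ 0 := by exact_mod_cast hq.ne_zero
  have hp0 : (p : ℤ) ≠ 0 := by exact_mod_cast hp.ne_zero
  obtain ⟨⟨-, h7qp, h7Q, h7P⟩, ⟨h7_q, -, hq07, hp07⟩⟩ := facts_threeOne hq8 hq7 hp8 hp7
  have hA : (-2 * (-42 * ((q : ℤ) * p))) = 84 * ((q : ℤ) * p) := by ring
  have hB : ((-42 * ((q : ℤ) * p)) ^ 2 - 4 * (448 * ((q : ℤ) * p) ^ 2)) = -28 * ((q : ℤ) * p) ^ 2 := by ring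
  have hb : (-28 * ((q : ℤ) * p) ^ 2 : ℤ) ≠ 0 := mul_ne_zero (by norm_num) (pow_ne_zero 2 (mul_ne_zero hq0 hp0))
  intro d hd
  rw [twoIsogenySelmerGroup'_eq, hA, hB, mem_twoIsogenySelmerGroup_iff hb] at hd
  obtain ⟨hsqf, ⟨d', hdd'⟩, hloc⟩ := hd
  have hd'eq : (-28 * ((q : ℤ) * p) ^ 2 : ℤ) / d = d' := by rw [hdd', Int.mul_ediv_cancel_left _ hsqf.ne_zero]
  rw [hd'eq] at hloc
  obtain ⟨-, hpadic⟩ := hloc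
  simp only [Finset.mem_insert, Finset.mem_singleton]
  by_cases hpd : (p : ℤ) ∣ d
  · -- `p ∣ d`: `d ∈ {p, −7p, 2p, −14p}` by §1
    obtain ⟨e, rfl⟩ := hpd
    rcases mem_of_prime_dvd_of_mem_twoIsogenySelmerGroup'_twoPrimesTwist_threeOne hq8 hq7 hp8 hp7 hsqf hdd' hpadic rfl
      with rfl | rfl | rfl | rfl
    · exact Or.inr (Or.inr (Or.inr (Or.inr (Or.inl (by ring)))))
    · exact Or.inr (Or.inr (Or.inr (Or.inr (Or.inr (Or.inl rfl)))))
    · exact Or.inr (Or.inr (Or.inr (Or.inr (Or.inr (Or.inr (Or.inl rfl))))))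
    · exact Or.inr (Or.inr (Or.inr (Or.inr (Or.inr (Or.inr (Or.inr rfl))))))
  · have h0 : d ∣ -28 * ((q : ℤ) * p) ^ 2 := ⟨d', hdd'⟩
    have h1 : d ∣ (14 * ((q : ℤ) * p)) ^ 2 := h0.trans ⟨-7, by ring⟩
    have h14qp : d ∣ 14 * ((q : ℤ) * p) := (hsqf.dvd_pow_iff_dvd (by norm_num)).mp h1
    have hcopp : IsCoprime d (p : ℤ) := ((hpZ.irreducible.coprime_iff_not_dvd).mpr hpd).symm
    have h14q : d ∣ 14 * (q : ℤ) := hcopp.dvd_of_dvd_mul_right (by rw [show 14 * (q : ℤ) * p = 14 * (q * p) by ring]; exact h14qp)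
    by_cases hqd : (q : ℤ) ∣ d
    · -- `d = q·e`, `e ∣ 14`: all eight die (`q, 2q, −7q, −14q` at `7`; `−q, 7q, −2q, 14q` at `2`)
      exfalso
      obtain ⟨e, rfl⟩ := hqd
      have he14 : e ∣ 14 := by
        have : (q : ℤ) * e ∣ (q : ℤ) * 14 := by rw [mul_comm (q : ℤ) 14]; exact h14q
        exact (mul_dvd_mul_iff_left hq0).mp this
      have hd'e : e * d' = -28 * (q : ℤ) * p ^ 2 := mul_left_cancel₀ hq0 (by linear_combination (-1 : ℤ) * hdd')
      have hele : e ≤ 14 := Int.le_of_dvd (by norm_num) he14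
      have hege : -14 ≤ e := by have := Int.le_of_dvd (by norm_num) ((Int.neg_dvd).mpr he14); linarith
      have hne1 : e ≠ 1 := by
        rintro rfl; exact not_isSoluble_seven_dual h7qp hdd'.symm (not_seven_dvd_mul_threeOne h7Q (by decide))
          (by rw [legendreSym.mul, h7_q]; norm_num) (hpadic 7)
      have hne2 : e ≠ 2 := by
        rintro rfl; exact not_isSoluble_seven_dual h7qp hdd'.symm (not_seven_dvd_mul_threeOne h7Q (by decide))
          (by rw [legendreSym.mul, h7_q]; norm_num) (hpadic 7)
      have hnem7 : e ≠ -7 := by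
        rintro rfl
        have hd'1 : d' = 4 * ((q : ℤ) * (p : ℤ) ^ 2) := mul_left_cancel₀ (by norm_num : (-7 : ℤ) ≠ 0) (by linear_combination hd'e)
        refine not_isSoluble_seven_dual' h7qp hdd'.symm ?_ ?_ (hpadic 7)
        · rw [hd'1]
          exact not_seven_dvd_mul_threeOne (by decide) (not_seven_dvd_mul_threeOne h7Q (by rw [sq]; exact not_seven_dvd_mul_threeOne h7P h7P))
        · rw [hd'1, legendreSym.mul, legendreSym.mul, legendreSym.sq_one' 7 hp07, h7_q]; norm_num
      have hnem14 : e ≠ -14 := by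
        rintro rfl
        have hd'1 : d' = 2 * ((q : ℤ) * (p : ℤ) ^ 2) := mul_left_cancel₀ (by norm_num : (-14 : ℤ) ≠ 0) (by linear_combination hd'e)
        refine not_isSoluble_seven_dual' h7qp hdd'.symm ?_ ?_ (hpadic 7)
        · rw [hd'1]
          exact not_seven_dvd_mul_threeOne (by decide) (not_seven_dvd_mul_threeOne h7Q (by rw [sq]; exact not_seven_dvd_mul_threeOne h7P h7P))
        · rw [hd'1, legendreSym.mul, legendreSym.mul, legendreSym.sq_one' 7 hp07, h7_q]; norm_num
      have hnem1 : e ≠ -1 := by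
        rintro rfl; exact not_isSoluble_two_dual_negQ_threeOne hq8 hp8 rfl (by ring)
          (mul_left_cancel₀ (by norm_num : (-1 : ℤ) ≠ 0) (by linear_combination hd'e)) (hpadic 2)
      have hne7 : e ≠ 7 := by
        rintro rfl; exact not_isSoluble_two_dual_sevenQ_threeOne hq8 hp8 rfl (by ring)
          (mul_left_cancel₀ (by norm_num : (7 : ℤ) ≠ 0) (by linear_combination hd'e)) (hpadic 2)
      have hnem2 : e ≠ -2 := by
        rintro rfl; exact not_isSoluble_two_dual_negTwoQ_threeOne hq8 hp8 rfl (by ring)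
          (mul_left_cancel₀ (by norm_num : (-2 : ℤ) ≠ 0) (by linear_combination hd'e)) (hpadic 2)
      have hne14 : e ≠ 14 := by
        rintro rfl; exact not_isSoluble_two_dual_fourteenQ_threeOne hq8 hp8 rfl (by ring)
          (mul_left_cancel₀ (by norm_num : (14 : ℤ) ≠ 0) (by linear_combination hd'e)) (hpadic 2)
      obtain ⟨k, hk⟩ := he14
      interval_cases e <;> omega
    · have hcop : IsCoprime d (q : ℤ) := ((hqZ.irreducible.coprime_iff_not_dvd).mpr hqd).symm
      have hd14 : d ∣ 14 := hcop.dvd_of_dvd_mul_right h14q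
      have hle : d ≤ 14 := Int.le_of_dvd (by norm_num) hd14
      have hge : -14 ≤ d := by have := Int.le_of_dvd (by norm_num) ((Int.neg_dvd).mpr hd14); linarith
      -- at `7`: `−1`, `−2` (test `d`), `7`, `14` (test `d′`); `1, −7, 2, −14` survive
      have hnm1 : d ≠ -1 := by
        rintro rfl; exact not_isSoluble_seven_dual h7qp hdd'.symm (by decide) (by norm_num) (hpadic 7)
      have hnm2 : d ≠ -2 := by
        rintro rfl; exact not_isSoluble_seven_dual h7qp hdd'.symm (by decide) (by norm_num) (hpadic 7)
      have h7QP : ¬ (7 : ℤ) ∣ ((q : ℤ) * p) ^ 2 := by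
        rw [sq]; exact not_seven_dvd_mul_threeOne (not_seven_dvd_mul_threeOne h7Q h7P) (not_seven_dvd_mul_threeOne h7Q h7P)
      have hQP07 : ((((q : ℤ) * p : ℤ)) : ZMod 7) ≠ 0 := by push_cast at hq07 hp07 ⊢; exact mul_ne_zero hq07 hp07
      have hn7 : d ≠ 7 := by
        rintro rfl
        have hd'1 : d' = -4 * ((q : ℤ) * p) ^ 2 := by linarith
        refine not_isSoluble_seven_dual' h7qp hdd'.symm ?_ ?_ (hpadic 7)
        · rw [hd'1]; exact not_seven_dvd_mul_threeOne (by decide) h7QP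
        · rw [hd'1, legendreSym.mul, legendreSym.sq_one' 7 hQP07]; norm_num
      have hn14 : d ≠ 14 := by
        rintro rfl
        have hd'1 : d' = -2 * ((q : ℤ) * p) ^ 2 := by linarith
        refine not_isSoluble_seven_dual' h7qp hdd'.symm ?_ ?_ (hpadic 7)
        · rw [hd'1]; exact not_seven_dvd_mul_threeOne (by decide) h7QP
        · rw [hd'1, legendreSym.mul, legendreSym.sq_one' 7 hQP07]; norm_num
      obtain ⟨k, hk⟩ := hd14
      interval_cases d <;> first | (exfalso; omega) | simp

/-- **`#S′ = #S(84qp, −28q²p²) ≤ 8` on the stratum `q ≡ 3 (8)`, `(q/7) = −1`, `p ≡ 1 (8)`, `(−7/p) = +1`** (sharp on C1 and b31+ by the kit,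
memo NONSHARP-CHIZ-VANISHING §0). [cite: SilvermanAEC2009, Prop. X.4.9 and Example X.4.10] -/
theorem card_twoIsogenySelmerGroup'_twoPrimesTwist_le_eight_threeOne (hq8 : q % 8 = 3) (hq7 : jacobiSym q 7 = -1) (hp8 : p % 8 = 1)
    (hp7 : legendreSym p (-7) = 1) :
    (twoIsogenySelmerGroup' (-42 * ((q : ℤ) * p)) (448 * ((q : ℤ) * p) ^ 2)).card ≤ 8 :=
  (Finset.card_le_card (twoIsogenySelmerGroup'_twoPrimesTwist_subset_threeOne hq8 hq7 hp8 hp7)).trans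
    ((Finset.card_insert_le _ _).trans (Nat.succ_le_succ ((Finset.card_insert_le _ _).trans (Nat.succ_le_succ Finset.card_le_six))))

end SelmerDualThreeOne

end Summit.BirchSwinnertonDyer.BirchSwinnertonDyer.Theorems.GoldfeldGoodTwists

end
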